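import Mathlib
import Summits.Ventures.HodgeRepro2.T5LocalRingGaussSum

/-!
# T5DVRQuotientModel — the finite local ring `𝒪/𝔭^{m+1}` of a discrete valuation ring as the model of
`𝒪_v/𝔭_v^n`: units, annihilator of the maximal ideal, primitive characters, and the Gauss-sum identity

Kernel support for Tier 5, sub-step N5 / §G, reading residual [R-4] («Tate half»; route/T5-CHECK-G-p7.md §4,
§12.2 row P1.7, §16) — the companion of `T5LocalRingGaussSum`, which proves `G(χ,ψ)·G(χ⁻¹,ψ⁻¹) = |R|` for a
primitive multiplicative character `χ` (`IsPrimitiveChar`) and a primitive additive character `ψ` of an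
abstract finite local ring `R`. Here `R` is made concrete: `R = 𝒪 ⧸ (ϖ^{m+1})` for a discrete valuation
ring `𝒪` with uniformiser `ϖ` (in the application `𝒪 = 𝒪_v`, `m + 1 = n` the conductor exponent), and the
abstract hypotheses are translated into the language of print:

* `isLocalRing_quot`: `𝒪 ⧸ (ϖ^{m+1})` is a local ring; `isUnit_mk_iff`: `π x` is a unit iff `ϖ ∤ x`;
* `killsNonunits_mk_iff`: `π c` annihilates the maximal ideal iff `ϖ^m ∣ c`, i.e. `Ann(𝔪) = 𝔭^m/𝔭^{m+1}`;
* `isPrimitiveChar_iff`: `χ` is primitive iff `χ(π t) ≠ 1` for some `t ≡ 1 (mod ϖ^m)`, `ϖ ∤ t` —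
  «`χ` has conductor exactly `𝔭^{m+1}`» (non-trivial on `1 + 𝔭^m`);
* `isPrimitive_iff_socle`: `ψ` is primitive (`AddChar.IsPrimitive`) iff it is non-trivial on the socle
  `𝔭^m/𝔭^{m+1}` — `ψ(π (r ϖ^m)) ≠ 1` for some `r`;
* `isPrimitive_iff_of_fractionField`: if `ψ(π x) = Ψ(x / ϖ^{m+1})` for an additive character `Ψ` of the
  fraction field `K` of `𝒪` («`ψ_n(x) = ψ_v(x ϖ^{-n})`»), then `ψ` is primitive iff `Ψ` is non-trivial on
  `𝔭^{-1} = ϖ^{-1}𝒪` — i.e. iff the conductor of `Ψ` is not larger than `𝒪` (for `Ψ` trivial on `𝒪`: «`Ψ`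
  has conductor exactly `𝒪`», Kudla's normalisation of `ψ_v`);
* `shiftChar` / `shiftChar_mk` / `isPrimitive_shiftChar_iff`: the construction of that `ψ_n` (descent of
  `x ↦ Ψ(x / ϖ^{m+1})` to the quotient, `descend`) and its primitivity criterion;
* `gaussSum_mul_gaussSum_inv_eq_card_quot` / `gNorm_mul_gNorm_inv_quot` / `gNorm_mul_gNorm_inv_shiftChar`:
  the Gauss-sum identity on `𝒪 ⧸ (ϖ^{m+1})` under exactly these printed-shape hypotheses.

Finiteness of `𝒪 ⧸ (ϖ^{m+1})` (finite residue field) is taken as an instance hypothesis where it is needed.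
Nothing about local fields, conductors of characters of `F_v^×`, or ε-factors is defined here.
-/

namespace Summit.Ventures.HodgeRepro2.T5DVRQuotientModel

open Summit.Ventures.HodgeRepro2.T5LocalRingGaussSum

variable {𝒪 : Type*} [CommRing 𝒪] [IsDomain 𝒪] [IsDiscreteValuationRing 𝒪] {ϖ : 𝒪} {m : ℕ}

/-- The quotient map `𝒪 → 𝒪 ⧸ (ϖ^{m+1})`. -/
local notation "π" => Ideal.Quotient.mk (Ideal.span ({ϖ ^ (m + 1)} : Set 𝒪))

/-! ### The ring `𝒪 ⧸ (ϖ^{m+1})`: non-trivial, local, units -/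

section Ring

omit [IsDomain 𝒪] [IsDiscreteValuationRing 𝒪] in
/-- `ϖ^{m+1}` is not a unit, so `(ϖ^{m+1}) ≠ ⊤`. -/
theorem span_pow_ne_top (hϖ : Irreducible ϖ) : Ideal.span ({ϖ ^ (m + 1)} : Set 𝒪) ≠ ⊤ := by
  rw [Ne, Ideal.span_singleton_eq_top, pow_succ, IsUnit.mul_iff]
  exact fun h => hϖ.not_isUnit h.2

omit [IsDomain 𝒪] [IsDiscreteValuationRing 𝒪] in
/-- `𝒪 ⧸ (ϖ^{m+1})` is non-trivial. -/
theorem nontrivial_quot (hϖ : Irreducible ϖ) : Nontrivial (𝒪 ⧸ Ideal.span ({ϖ ^ (m + 1)} : Set 𝒪)) :=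
  Ideal.Quotient.nontrivial_iff.2 (span_pow_ne_top hϖ)

/-- `𝒪 ⧸ (ϖ^{m+1})` is a local ring (a quotient of the local ring `𝒪` by a proper ideal). -/
theorem isLocalRing_quot (hϖ : Irreducible ϖ) :
    IsLocalRing (𝒪 ⧸ Ideal.span ({ϖ ^ (m + 1)} : Set 𝒪)) := by
  haveI := nontrivial_quot (m := m) hϖ
  exact IsLocalRing.of_surjective' _ Ideal.Quotient.mk_surjective

omit [IsDomain 𝒪] [IsDiscreteValuationRing 𝒪] in
/-- `ϖ^{m+1} ∣ x ↔ π x = 0`. -/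
theorem mk_eq_zero_iff (x : 𝒪) : π x = 0 ↔ ϖ ^ (m + 1) ∣ x := by
  rw [Ideal.Quotient.eq_zero_iff_mem, Ideal.mem_span_singleton]

/-- In a DVR, `x` is a unit iff `ϖ ∤ x`. -/
theorem isUnit_iff_not_dvd (hϖ : Irreducible ϖ) (x : 𝒪) : IsUnit x ↔ ¬ ϖ ∣ x := by
  rw [← Ideal.mem_span_singleton, ← hϖ.maximalIdeal_eq, IsLocalRing.mem_maximalIdeal,
    mem_nonunits_iff, not_not]

/-- `π x` is a unit of `𝒪 ⧸ (ϖ^{m+1})` iff `ϖ ∤ x`: the units of `𝒪/𝔭^{m+1}` are the classes of the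
units of `𝒪`. -/
theorem isUnit_mk_iff (hϖ : Irreducible ϖ) (x : 𝒪) : IsUnit (π x) ↔ ¬ ϖ ∣ x := by
  constructor
  · intro h hx
    obtain ⟨u, hu⟩ := h
    obtain ⟨y, hy⟩ := Ideal.Quotient.mk_surjective (↑u⁻¹ : 𝒪 ⧸ Ideal.span ({ϖ ^ (m + 1)} : Set 𝒪))
    have h1 : π (x * y) = π 1 := by rw [map_mul, ← hu, hy, map_one, Units.mul_inv]
    have h2 : ϖ ^ (m + 1) ∣ x * y - 1 := by
      rw [← Ideal.mem_span_singleton]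
      exact Ideal.Quotient.eq.1 h1
    have h3 : ϖ ∣ x * y - (x * y - 1) :=
      (hx.mul_right y).sub ((dvd_pow_self ϖ (Nat.succ_ne_zero m)).trans h2)
    rw [show x * y - (x * y - 1) = 1 by ring] at h3
    exact hϖ.not_isUnit (isUnit_of_dvd_one h3)
  · intro hx
    exact ((isUnit_iff_not_dvd hϖ x).2 hx).map (Ideal.Quotient.mk _)

end Ring

/-! ### The annihilator of the maximal ideal and primitive multiplicative characters -/

section Characters

/-- `π c` kills the non-units of `𝒪 ⧸ (ϖ^{m+1})` iff `ϖ^m ∣ c`: the annihilator of the maximal ideal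
`𝔭/𝔭^{m+1}` is `𝔭^m/𝔭^{m+1}`. -/
theorem killsNonunits_mk_iff (hϖ : Irreducible ϖ) (c : 𝒪) :
    KillsNonunits (π c) ↔ ϖ ^ m ∣ c := by
  constructor
  · intro h
    have hϖ' : ¬ IsUnit (π ϖ) := by
      rw [isUnit_mk_iff hϖ, not_not]
    have h1 := h _ hϖ'
    rw [← map_mul, mk_eq_zero_iff, pow_succ, mul_comm ϖ c] at h1
    exact (mul_dvd_mul_iff_right hϖ.ne_zero).1 h1
  · intro hc y hy
    obtain ⟨y', rfl⟩ := Ideal.Quotient.mk_surjective y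
    rw [isUnit_mk_iff hϖ, not_not] at hy
    rw [← map_mul, mk_eq_zero_iff, pow_succ, mul_comm (ϖ ^ m) ϖ]
    exact mul_dvd_mul hy hc

/-- `χ` is primitive on `𝒪 ⧸ (ϖ^{m+1})` iff it is non-trivial at the class of some `t ∈ 𝒪^×` with
`t ≡ 1 (mod ϖ^m)`: «the conductor of `χ` is exactly `𝔭^{m+1}`» (non-triviality on `1 + 𝔭^m`). -/
theorem isPrimitiveChar_iff (hϖ : Irreducible ϖ) {R' : Type*} [CommMonoidWithZero R']
    (χ : MulChar (𝒪 ⧸ Ideal.span ({ϖ ^ (m + 1)} : Set 𝒪)) R') :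
    IsPrimitiveChar χ ↔ ∃ t : 𝒪, ¬ ϖ ∣ t ∧ ϖ ^ m ∣ t - 1 ∧ χ (π t) ≠ 1 := by
  constructor
  · rintro ⟨u, hu, hχ⟩
    obtain ⟨t, ht⟩ := Ideal.Quotient.mk_surjective (u : 𝒪 ⧸ Ideal.span ({ϖ ^ (m + 1)} : Set 𝒪))
    refine ⟨t, ?_, ?_, ?_⟩
    · rw [← isUnit_mk_iff hϖ, ht]
      exact u.isUnit
    · rw [← killsNonunits_mk_iff hϖ, map_sub, map_one, ht]
      exact hu
    · rw [ht]
      exact hχ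
  · rintro ⟨t, ht, ht1, hχ⟩
    obtain ⟨u, hu⟩ := (isUnit_mk_iff hϖ t).2 ht
    refine ⟨u, ?_, ?_⟩
    · rw [hu, ← map_one (Ideal.Quotient.mk _), ← map_sub, killsNonunits_mk_iff hϖ]
      exact ht1
    · rw [hu]
      exact hχ

omit [IsDiscreteValuationRing 𝒪] in
/-- `ϖ^{m+1} ∤ ϖ^m`, so the socle generator `π (ϖ^m)` is non-zero. -/
theorem mk_pow_ne_zero (hϖ : Irreducible ϖ) : π (ϖ ^ m) ≠ 0 := by
  rw [Ne, mk_eq_zero_iff, pow_succ]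
  intro h
  have h' : ϖ ^ m * ϖ ∣ ϖ ^ m * 1 := by rwa [mul_one]
  exact hϖ.not_isUnit (isUnit_of_dvd_one ((mul_dvd_mul_iff_left (pow_ne_zero m hϖ.ne_zero)).1 h'))

/-- An additive character `ψ` of `𝒪 ⧸ (ϖ^{m+1})` is primitive iff it is non-trivial on the socle
`𝔭^m/𝔭^{m+1}`: `ψ (π (r * ϖ^m)) ≠ 1` for some `r ∈ 𝒪`. (The socle is the unique minimal non-zero ideal
of the chain ring `𝒪/𝔭^{m+1}`; a primitive character is one whose kernel contains no non-zero ideal.) -/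
theorem isPrimitive_iff_socle (hϖ : Irreducible ϖ) {R' : Type*} [CommMonoid R']
    (ψ : AddChar (𝒪 ⧸ Ideal.span ({ϖ ^ (m + 1)} : Set 𝒪)) R') :
    ψ.IsPrimitive ↔ ∃ r : 𝒪, ψ (π (r * ϖ ^ m)) ≠ 1 := by
  constructor
  · intro hψ
    obtain ⟨z, hz⟩ := AddChar.ne_one_iff.1 (hψ (mk_pow_ne_zero hϖ))
    obtain ⟨r, rfl⟩ := Ideal.Quotient.mk_surjective z
    refine ⟨r, ?_⟩
    rwa [AddChar.mulShift_apply, ← map_mul, mul_comm] at hz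
  · rintro ⟨r, hr⟩ a ha
    obtain ⟨x, rfl⟩ := Ideal.Quotient.mk_surjective a
    have hx : x ≠ 0 := by
      rintro rfl
      exact ha (map_zero _)
    obtain ⟨j, u, rfl⟩ := IsDiscreteValuationRing.eq_unit_mul_pow_irreducible hx hϖ
    have hj : j ≤ m := by
      by_contra hj
      apply ha
      rw [mk_eq_zero_iff]
      exact Dvd.dvd.mul_left (pow_dvd_pow ϖ (by omega)) _
    rw [AddChar.ne_one_iff]
    refine ⟨π ((u⁻¹ : 𝒪ˣ) * r * ϖ ^ (m - j)), ?_⟩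
    rw [AddChar.mulShift_apply, ← map_mul]
    convert hr using 3
    rw [show (u : 𝒪) * ϖ ^ j * (((u⁻¹ : 𝒪ˣ) : 𝒪) * r * ϖ ^ (m - j))
        = ((u : 𝒪) * ((u⁻¹ : 𝒪ˣ) : 𝒪)) * r * (ϖ ^ j * ϖ ^ (m - j)) by ring,
      Units.mul_inv, one_mul, ← pow_add, Nat.add_sub_cancel' hj]

end Characters

/-! ### The additive character `x ↦ Ψ(x ϖ^{-(m+1)})` of the fraction field -/

section FractionField

variable {K : Type*} [Field K] [Algebra 𝒪 K] [IsFractionRing 𝒪 K]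

/-- If `ψ (π x) = Ψ (x / ϖ^{m+1})` for an additive character `Ψ` of the fraction field `K` of `𝒪`
(«`ψ_n(x) = ψ_v(x ϖ^{-n})`»), then `ψ` is primitive on `𝒪 ⧸ (ϖ^{m+1})` iff `Ψ` is non-trivial on
`ϖ^{-1}𝒪`: the conductor of `Ψ` is not larger than `𝒪` (for `Ψ` trivial on `𝒪`, «the conductor of `Ψ` is
exactly `𝒪`»). -/
theorem isPrimitive_iff_of_fractionField (hϖ : Irreducible ϖ) {R' : Type*} [CommMonoid R']
    (ψ : AddChar (𝒪 ⧸ Ideal.span ({ϖ ^ (m + 1)} : Set 𝒪)) R') (Ψ : AddChar K R')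
    (hψ : ∀ x : 𝒪, ψ (π x) = Ψ (algebraMap 𝒪 K x / algebraMap 𝒪 K ϖ ^ (m + 1))) :
    ψ.IsPrimitive ↔ ∃ y : 𝒪, Ψ (algebraMap 𝒪 K y / algebraMap 𝒪 K ϖ) ≠ 1 := by
  have hϖK : algebraMap 𝒪 K ϖ ≠ 0 := by
    rw [Ne, IsFractionRing.to_map_eq_zero_iff]
    exact hϖ.ne_zero
  have key : ∀ r : 𝒪, ψ (π (r * ϖ ^ m)) = Ψ (algebraMap 𝒪 K r / algebraMap 𝒪 K ϖ) := by
    intro r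
    rw [hψ, map_mul, map_pow, pow_succ]
    congr 1
    field_simp
  rw [isPrimitive_iff_socle hϖ]
  simp_rw [key]

/-! #### The construction of `ψ_n`: descent of `x ↦ Ψ(x ϖ^{-(m+1)})` to the quotient -/

omit [IsDomain 𝒪] [IsDiscreteValuationRing 𝒪] in
/-- An additive character of a commutative ring `R` that is trivial on an ideal `I` descends to the
quotient ring `R ⧸ I` (`R ⧸ I` is by definition the quotient of the additive group `R` by `I`, so
`QuotientAddGroup.lift` applies). -/
noncomputable def descend {R : Type*} [CommRing R] (I : Ideal R) {M : Type*} [CommMonoid M]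
    (Ψ₀ : AddChar R M) (h : ∀ x ∈ I, Ψ₀ x = 1) : AddChar (R ⧸ I) M :=
  AddChar.toAddMonoidHomEquiv.symm
    (QuotientAddGroup.lift I.toAddSubgroup Ψ₀.toAddMonoidHom (fun x hx => by
      simp [AddChar.toAddMonoidHom_apply, h x hx]))

omit [IsDomain 𝒪] [IsDiscreteValuationRing 𝒪] in
/-- The descended character at a class is the original character at a representative. -/
@[simp] theorem descend_mk {R : Type*} [CommRing R] (I : Ideal R) {M : Type*} [CommMonoid M]
    (Ψ₀ : AddChar R M) (h : ∀ x ∈ I, Ψ₀ x = 1) (x : R) :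
    descend I Ψ₀ h (Ideal.Quotient.mk I x) = Ψ₀ x := rfl

omit [IsDomain 𝒪] [IsDiscreteValuationRing 𝒪] in
/-- The additive character `x ↦ Ψ(x / ϖ^{m+1})` of `𝒪` («`ψ_v(x ϖ^{-n})`» on `𝒪_v`), for an additive
character `Ψ` of the fraction field. -/
noncomputable def shiftCharAux {M : Type*} [CommMonoid M] (Ψ : AddChar K M) (ϖ : 𝒪) (m : ℕ) :
    AddChar 𝒪 M :=
  Ψ.compAddMonoidHom
    ((AddMonoidHom.mulRight (algebraMap 𝒪 K ϖ ^ (m + 1))⁻¹).comp (algebraMap 𝒪 K).toAddMonoidHom)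

omit [IsDomain 𝒪] [IsDiscreteValuationRing 𝒪] [IsFractionRing 𝒪 K] in
/-- `shiftCharAux Ψ ϖ m x = Ψ (x / ϖ^{m+1})`. -/
@[simp] theorem shiftCharAux_apply {M : Type*} [CommMonoid M] (Ψ : AddChar K M) (ϖ : 𝒪) (m : ℕ)
    (x : 𝒪) :
    shiftCharAux Ψ ϖ m x = Ψ (algebraMap 𝒪 K x / algebraMap 𝒪 K ϖ ^ (m + 1)) := by
  simp [shiftCharAux, div_eq_mul_inv]

omit [IsDomain 𝒪] [IsDiscreteValuationRing 𝒪] in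
/-- If `Ψ` is trivial on `𝒪`, then `x ↦ Ψ(x / ϖ^{m+1})` is trivial on the ideal `(ϖ^{m+1})`. -/
theorem shiftCharAux_eq_one_of_mem (hϖ : Irreducible ϖ) {M : Type*} [CommMonoid M]
    (Ψ : AddChar K M) (hΨ : ∀ x : 𝒪, Ψ (algebraMap 𝒪 K x) = 1) {x : 𝒪}
    (hx : x ∈ Ideal.span ({ϖ ^ (m + 1)} : Set 𝒪)) : shiftCharAux Ψ ϖ m x = 1 := by
  obtain ⟨y, rfl⟩ := Ideal.mem_span_singleton.1 hx
  have hϖK : algebraMap 𝒪 K ϖ ≠ 0 := by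
    rw [Ne, IsFractionRing.to_map_eq_zero_iff]
    exact hϖ.ne_zero
  rw [shiftCharAux_apply, map_mul, map_pow, mul_div_cancel_left₀ _ (pow_ne_zero _ hϖK)]
  exact hΨ y

variable (m) in
/-- **The character `ψ_n`.** For an additive character `Ψ` of the fraction field `K` of `𝒪` that is
trivial on `𝒪` (conductor `⊇ 𝒪`), the additive character `π x ↦ Ψ(x ϖ^{-(m+1)})` of `𝒪 ⧸ (ϖ^{m+1})` —
Kudla's `ψ_n(x) = ψ_v(x ϖ^{-n})`, against which the Gauss sum `𝔤(ω|_U)` of Prop. 3.8 is formed. -/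
noncomputable def shiftChar (hϖ : Irreducible ϖ) {M : Type*} [CommMonoid M] (Ψ : AddChar K M)
    (hΨ : ∀ x : 𝒪, Ψ (algebraMap 𝒪 K x) = 1) :
    AddChar (𝒪 ⧸ Ideal.span ({ϖ ^ (m + 1)} : Set 𝒪)) M :=
  descend _ (shiftCharAux Ψ ϖ m) (fun _ hx => shiftCharAux_eq_one_of_mem hϖ Ψ hΨ hx)

omit [IsDomain 𝒪] [IsDiscreteValuationRing 𝒪] in
/-- `shiftChar m hϖ Ψ hΨ (π x) = Ψ (x / ϖ^{m+1})`. -/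
@[simp] theorem shiftChar_mk (hϖ : Irreducible ϖ) {M : Type*} [CommMonoid M] (Ψ : AddChar K M)
    (hΨ : ∀ x : 𝒪, Ψ (algebraMap 𝒪 K x) = 1) (x : 𝒪) :
    shiftChar m hϖ Ψ hΨ (π x) = Ψ (algebraMap 𝒪 K x / algebraMap 𝒪 K ϖ ^ (m + 1)) :=
  shiftCharAux_apply Ψ ϖ m x

/-- `ψ_n` is primitive on `𝒪 ⧸ (ϖ^{m+1})` iff `Ψ` is non-trivial on `ϖ^{-1}𝒪`: together with `hΨ`,
«`Ψ` has conductor exactly `𝒪`». -/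
theorem isPrimitive_shiftChar_iff (hϖ : Irreducible ϖ) {M : Type*} [CommMonoid M] (Ψ : AddChar K M)
    (hΨ : ∀ x : 𝒪, Ψ (algebraMap 𝒪 K x) = 1) :
    (shiftChar m hϖ Ψ hΨ).IsPrimitive ↔ ∃ y : 𝒪, Ψ (algebraMap 𝒪 K y / algebraMap 𝒪 K ϖ) ≠ 1 :=
  isPrimitive_iff_of_fractionField hϖ _ Ψ (fun x => shiftChar_mk hϖ Ψ hΨ x)

end FractionField

/-! ### The Gauss-sum identity on `𝒪 ⧸ (ϖ^{m+1})` under the printed-shape hypotheses -/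

section GaussSum

variable {R' : Type*} [CommRing R'] [IsDomain R']
  [Fintype (𝒪 ⧸ Ideal.span ({ϖ ^ (m + 1)} : Set 𝒪))]

/-- **The Gauss-sum identity on `𝒪/𝔭^{m+1}`.** For `χ` of conductor exactly `𝔭^{m+1}` (`χ(π t) ≠ 1` for
some `t ∈ 𝒪^×`, `t ≡ 1 (mod ϖ^m)`) and `ψ` non-trivial on the socle `𝔭^m/𝔭^{m+1}`,
`G(χ,ψ)·G(χ⁻¹,ψ⁻¹) = |𝒪/𝔭^{m+1}|` — `T5LocalRingGaussSum.gaussSum_mul_gaussSum_inv_eq_card` with its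
hypotheses read off in the language of print. -/
theorem gaussSum_mul_gaussSum_inv_eq_card_quot (hϖ : Irreducible ϖ)
    {χ : MulChar (𝒪 ⧸ Ideal.span ({ϖ ^ (m + 1)} : Set 𝒪)) R'} {t : 𝒪} (ht : ¬ ϖ ∣ t)
    (ht1 : ϖ ^ m ∣ t - 1) (hχ : χ (π t) ≠ 1)
    {ψ : AddChar (𝒪 ⧸ Ideal.span ({ϖ ^ (m + 1)} : Set 𝒪)) R'} {r : 𝒪}
    (hψ : ψ (π (r * ϖ ^ m)) ≠ 1) :
    gaussSum χ ψ * gaussSum χ⁻¹ ψ⁻¹ = Fintype.card (𝒪 ⧸ Ideal.span ({ϖ ^ (m + 1)} : Set 𝒪)) := by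
  haveI := isLocalRing_quot (m := m) hϖ
  exact gaussSum_mul_gaussSum_inv_eq_card ((isPrimitiveChar_iff hϖ χ).2 ⟨t, ht, ht1, hχ⟩)
    ((isPrimitive_iff_socle hϖ ψ).2 ⟨r, hψ⟩)

/-- The normalised form `𝔤(χ)·𝔤(χ⁻¹) = χ(−1)` on `𝒪/𝔭^{m+1}` (values in `ℂ`), under the same hypotheses:
the Gauss-sum identity of (T1) (CHECK-G §4) at conductor exponent `m + 1`. -/
theorem gNorm_mul_gNorm_inv_quot (hϖ : Irreducible ϖ)
    {χ : MulChar (𝒪 ⧸ Ideal.span ({ϖ ^ (m + 1)} : Set 𝒪)) ℂ} {t : 𝒪} (ht : ¬ ϖ ∣ t)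
    (ht1 : ϖ ^ m ∣ t - 1) (hχ : χ (π t) ≠ 1)
    {ψ : AddChar (𝒪 ⧸ Ideal.span ({ϖ ^ (m + 1)} : Set 𝒪)) ℂ} {r : 𝒪}
    (hψ : ψ (π (r * ϖ ^ m)) ≠ 1) :
    gNorm χ ψ * gNorm χ⁻¹ ψ = χ (-1) := by
  haveI := isLocalRing_quot (m := m) hϖ
  exact gNorm_mul_gNorm_inv ((isPrimitiveChar_iff hϖ χ).2 ⟨t, ht, ht1, hχ⟩)
    ((isPrimitive_iff_socle hϖ ψ).2 ⟨r, hψ⟩)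

/-- The Gauss-sum identity `𝔤(χ)·𝔤(χ⁻¹) = χ(−1)` on `𝒪/𝔭^{m+1}` against the character `ψ_n = shiftChar`
built from an additive character `Ψ` of the fraction field of conductor exactly `𝒪` (trivial on `𝒪`,
non-trivial on `ϖ^{-1}𝒪`), for `χ` of conductor exactly `𝔭^{m+1}`: every hypothesis in the shape of
print. -/
theorem gNorm_mul_gNorm_inv_shiftChar {K : Type*} [Field K] [Algebra 𝒪 K] [IsFractionRing 𝒪 K]
    (hϖ : Irreducible ϖ)
    {χ : MulChar (𝒪 ⧸ Ideal.span ({ϖ ^ (m + 1)} : Set 𝒪)) ℂ} {t : 𝒪} (ht : ¬ ϖ ∣ t)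
    (ht1 : ϖ ^ m ∣ t - 1) (hχ : χ (π t) ≠ 1) (Ψ : AddChar K ℂ)
    (hΨ : ∀ x : 𝒪, Ψ (algebraMap 𝒪 K x) = 1) {y : 𝒪}
    (hy : Ψ (algebraMap 𝒪 K y / algebraMap 𝒪 K ϖ) ≠ 1) :
    gNorm χ (shiftChar m hϖ Ψ hΨ) * gNorm χ⁻¹ (shiftChar m hϖ Ψ hΨ) = χ (-1) := by
  haveI := isLocalRing_quot (m := m) hϖ
  exact gNorm_mul_gNorm_inv ((isPrimitiveChar_iff hϖ χ).2 ⟨t, ht, ht1, hχ⟩)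
    ((isPrimitive_shiftChar_iff hϖ Ψ hΨ).2 ⟨y, hy⟩)

end GaussSum

end Summit.Ventures.HodgeRepro2.T5DVRQuotientModel
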